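/-
Copyright: rh-split cell (screw, prover seat l19) gen 0, 2026-08-27.  Splitting search over kernel-typed
RH-equivalences.  A splitting `A ∧ B ⟹ RH` is CONDITIONAL bookkeeping unless `A` and `B` are both
proved; nothing here bears on the truth of RH.
-/
import Summits.RiemannHypothesis.RiemannHypothesis.Theorems.Splittings.ScrewLassoCharge
import Summits.RiemannHypothesis.RiemannHypothesis.Theses.ScrewLasso
import HarnessLib

/-!
# Route X-13 `ScrewLasso` — item `ChargeContinuity` PROVED (RH-free), the route decl by name

Substance: `ScrewLassoCharge.rh_of_chargeContinuity` (file `ScrewLassoCharge.lean`): if the total aliased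
charge `∑_ρ discWeight (c_ρ) (u_ρ) 0 1` vanishes along steps `h → 0⁺`, then every non-trivial zero is on
the critical line (termwise limit `𝟙[Re ρ ≠ 1/2]·c_ρ/2`, Tannery, sign `Re c_ρ < 0`).  The route decl
`Theses.ScrewLasso.ChargeContinuity` is that statement verbatim.

RH is not proved by this: `ChargeContinuity` is one RH-free leg of the CONDITIONAL splitting X-13
`LassoFlux ∧ ChargeContinuity ∧ LassoFine ∧ CeilAll ⟹ RH` (`LassoFine`, `CeilAll` open conjectures).
No `sorry`, no new axioms, no instances, no notation.
-/

set_option linter.dupNamespace false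

namespace Summit.RiemannHypothesis.RiemannHypothesis.Theorems.Splittings.ScrewLassoCharge

/-- **Item `ChargeContinuity` of route `ScrewLasso` (X-13) — PROVED** (the route decl by name; RH-free). -/
theorem chargeContinuity_proof :
    Summit.RiemannHypothesis.RiemannHypothesis.Theses.ScrewLasso.ChargeContinuity :=
  fun hyp ↦ rh_of_chargeContinuity hyp

end Summit.RiemannHypothesis.RiemannHypothesis.Theorems.Splittings.ScrewLassoCharge
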